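import Literature.NumberTheory.LFunctions.KloostermanFractionsAmplifiedForm
import HarnessLib

/-!
# Bilinear forms with Kloosterman fractions: the amplified second moment over an arbitrary set of `m`

Topic `NumberTheory/LFunctions`.  `kfC_le_diag_add_off` of `KloostermanFractionsAmplifiedForm.lean`
(Bettin–Chandee, Adv. Math. 328 (2018), §2: "`𝓒_b ≪ M L^{-2+ε} 𝓓_b`", `𝓓_b = diagonal +
off-diagonal`) is stated for `m` running over `1 ≤ m ≤ 2M`, `(m,b) = 1`.  The later files of the
tree work with `m` in a range `(M₁, M₂]` (e.g. `m ∼ M`: `KloostermanFractionsFromCb.lean`,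
`KloostermanFractionsDiagonal.lean`); this file PROVES the same inequality for an ARBITRARY finite
set `S` of positive `m ≤ 2M` (`kfCS_le_diag_add_off`), with the identical proof (`|X_m|² ≤ φ(m) P⁻² Σ_m`,
`φ(m) ≤ m ≤ 2M`, `Σ_m ≥ 0`, `Σ_m = diag + off`), and records the specialisation to
`m ∈ (⌊M⌋, ⌊2M⌋]`, `(m, b) = 1` (`kfCI_le_diag_add_off`).

## References

* S. Bettin, V. Chandee, Adv. Math. 328 (2018) 1234–1262 (arXiv:1502.00769), §2 ((2.2) and the
  display defining `𝓓_b`). [BettinChandee2018]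
-/

noncomputable section

open Finset

namespace Literature.NumberTheory.LFunctions

/-- **The amplified second moment over a set `S` of `m`**: if `0 < P ≤ #{ℓ ∈ 𝓛 : (ℓ, m) = 1}` for
every `m ∈ S`, and every `m ∈ S` satisfies `1 ≤ m ≤ 2M`, then
`∑_{m ∈ S} |kfInner k b N' γ m|² ≤ (2M/P²) (‖∑_{m∈S} kfDiag m‖ + ‖∑_{m∈S} kfOff m‖)`.
[cite: BettinChandee2018, §2] -/
theorem kfCS_le_diag_add_off (k : ℤ) (b : ℕ) (M N' : ℝ) (γ : ℕ → ℂ) (𝓛 : Finset ℕ)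
    (S : Finset ℕ) (hS : ∀ m ∈ S, 0 < m ∧ (m : ℝ) ≤ 2 * M) {P : ℝ} (hP : 0 < P)
    (hP𝓛 : ∀ m ∈ S, P ≤ ((𝓛.filter (fun ℓ => ℓ.Coprime m)).card : ℝ)) :
    ∑ m ∈ S, ‖kfInner k b N' γ m‖ ^ 2 ≤ 2 * M / P ^ 2 *
      (‖∑ m ∈ S, kfDiag k b N' γ 𝓛 m‖ + ‖∑ m ∈ S, kfOff k b N' γ 𝓛 m‖) := by
  have hterm : ∀ m ∈ S, ‖kfInner k b N' γ m‖ ^ 2 ≤ 2 * M / P ^ 2 * (kfSigma k b N' γ 𝓛 m).re := by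
    intro m hm
    obtain ⟨hm0, hm2⟩ := hS m hm
    have h1 := norm_kfInner_sq_le k b N' γ 𝓛 hm0 hP (hP𝓛 m hm)
    have hre := (kfSigma_re_nonneg k b N' γ 𝓛 hm0).2
    have hφ : (m.totient : ℝ) ≤ 2 * M :=
      le_trans (by exact_mod_cast Nat.totient_le m) hm2
    calc ‖kfInner k b N' γ m‖ ^ 2 ≤ (m.totient : ℝ) / P ^ 2 * (kfSigma k b N' γ 𝓛 m).re := h1
      _ ≤ 2 * M / P ^ 2 * (kfSigma k b N' γ 𝓛 m).re := by gcongr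
  rcases S.eq_empty_or_nonempty with rfl | ⟨m₀, hm₀⟩
  · simp
  have hM : 0 ≤ 2 * M / P ^ 2 := by
    have h2 := (hS m₀ hm₀).2
    have h1 : (0 : ℝ) < m₀ := by exact_mod_cast (hS m₀ hm₀).1
    have : 0 ≤ M := by linarith
    positivity
  refine (Finset.sum_le_sum hterm).trans ?_
  rw [← Finset.mul_sum]
  refine mul_le_mul_of_nonneg_left ?_ hM
  rw [← Complex.re_sum]
  simp_rw [kfSigma_eq_kfDiag_add_kfOff]
  rw [Finset.sum_add_distrib, Complex.add_re]
  exact add_le_add (Complex.re_le_norm _) (Complex.re_le_norm _)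

/-- `kfCS_le_diag_add_off` for `m ∈ (⌊M⌋, ⌊2M⌋]`, `(m, b) = 1` — the range `m ∼ M` used in
`KloostermanFractionsFromCb.lean` (hypothesis `H52`) and `KloostermanFractionsFrom51.lean` (`H51`).
[cite: BettinChandee2018, §2 (2.2)] -/
theorem kfCI_le_diag_add_off (k : ℤ) (b : ℕ) (M N' : ℝ) (γ : ℕ → ℂ) (𝓛 : Finset ℕ)
    {P : ℝ} (hP : 0 < P)
    (hP𝓛 : ∀ m ∈ (Ioc ⌊M⌋₊ ⌊2 * M⌋₊).filter (fun m => m.Coprime b),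
      P ≤ ((𝓛.filter (fun ℓ => ℓ.Coprime m)).card : ℝ)) :
    ∑ m ∈ (Ioc ⌊M⌋₊ ⌊2 * M⌋₊).filter (fun m => m.Coprime b), ‖kfInner k b N' γ m‖ ^ 2 ≤
      2 * M / P ^ 2 *
      (‖∑ m ∈ (Ioc ⌊M⌋₊ ⌊2 * M⌋₊).filter (fun m => m.Coprime b), kfDiag k b N' γ 𝓛 m‖ +
        ‖∑ m ∈ (Ioc ⌊M⌋₊ ⌊2 * M⌋₊).filter (fun m => m.Coprime b), kfOff k b N' γ 𝓛 m‖) := by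
  refine kfCS_le_diag_add_off k b M N' γ 𝓛 _ ?_ hP hP𝓛
  intro m hm
  simp only [Finset.mem_filter, Finset.mem_Ioc] at hm
  refine ⟨by omega, ?_⟩
  have h2 : m ≤ ⌊2 * M⌋₊ := hm.1.2
  have hm0 : 0 < ⌊2 * M⌋₊ := by omega
  have hM : 0 ≤ 2 * M := by
    by_contra h
    push Not at h
    have := Nat.floor_eq_zero.2 (h.trans (by norm_num : (0:ℝ) < 1))
    omega
  calc (m : ℝ) ≤ (⌊2 * M⌋₊ : ℝ) := by exact_mod_cast h2
    _ ≤ 2 * M := Nat.floor_le hM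

end Literature.NumberTheory.LFunctions

end
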